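import Literature.Combinatorics.Optimization.ShellLawLevelStep
import HarnessLib

/-!
# The edge-product formula for the shell generating function, and the TYPE STEP

For a perfect matching `π` (a fixed-point-free involution), a `π`-stable ground set `S` (a set of
`N` edges) and a block `H`, grade every `U ⊆ S` by `(|U ∩ H|, |full U|, |half U|)` — the block count,
the number of fully matched vertices (`= 2·#full edges`) and the number of half-matched vertices — and
form the three-variable generating function
`Ψ_S(X; Y, Z) = Σ_{U ⊆ S} X^{|U∩H|} Y^{|full U|} Z^{|half U|}`
(here: a polynomial in `Z` over polynomials in `Y` over `ℝ[X]`; its `Z^c Y^{2s}` coefficient is the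
shell generating polynomial `G_S(c+2s,c) = Σ_{U ∈ Shell_S(c+2s,c)} X^{|U∩H|}` of
`ShellLawGeneratingPolynomial.lean`, `coeff_coeff_shellGF`). Each EDGE `{v, πv}` of `S` contributes
independently one of four states (untouched; half-matched at `v`; half-matched at `πv`; fully matched),
so `Ψ_S` FACTORISES over the edges (`shellGF_eq_prod`), and grouping the edges by `H`-type,

> `Ψ_S = A^a · B^b · D^d`,  `A = 1 + 2ZX + Y²X²` (`HH` edge), `B = 1 + Z + ZX + Y²X` (mixed edge),
> `D = 1 + 2Z + Y²` (`H̄H̄` edge)   (`shellGF_eq_pow_mul_pow_mul_pow`),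

`(a, b, d)` the numbers of edges of the three types. Consequences: the shell law of the block statistic
depends on `S` only through `(a, b, d)`; and the **TYPE STEP** (eng MEMO-19/STATUS 2026-08-28 13:27Z,
found numerically): trading one `HH` and one `H̄H̄` edge for two mixed edges changes `Ψ` by
`A·D − B² = (Y² − Z²)(1 − X)²` times the generating function of the common remainder
(`typeStep_factor`, `shellGF_typeStep`), i.e. coefficientwise
`G_{(a+1,b,d+1)}(c+2s,c) − G_{(a,b+2,d)}(c+2s,c) = (1−X)²·[G_{(a,b,d)}(c+2(s−1),c) − G_{(a,b,d)}((c−2)+2s,c−2)]`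
(`shellGen_typeStep`) — a second `x`-difference, the sibling of the level step of
`ShellLawLevelStep.lean`.

All PROVED, 0 sorry, no definitions, no named facts; cell pnp-psdrank (lit g32; eng g20's exact identity).

## References

* [Rothvoss2017] T. Rothvoß, *The matching polytope has exponential extension complexity*, J. ACM 64
  (2017), §2 (cuts and their partition by a perfect matching; PDF pp. 5–6).
* [GodsilMeagher2015] C. Godsil, K. Meagher, *Erdős–Ko–Rado Theorems: Algebraic Approaches* (2015),
  §15.2 (perfect matchings as fixed-point-free involutions).
-/

noncomputable section

open Finset Polynomial

namespace Literature.Combinatorics.Optimization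

namespace ShellStep

variable {n : ℕ} {π : Fin n → Fin n}

section EdgeProduct

variable (hπ : ∀ v, π (π v) = v) (hπ' : ∀ v, π v ≠ v)
include hπ hπ'

/-! ### §1 Adding one edge: how `half`, `full` and the block count change -/

/-- Adding one endpoint `v` of an edge outside `U`: `v` becomes half-matched, nothing else changes.
[cite: Rothvoss2017, §2 (PDF p. 5)] -/
theorem half_insert_of_notMem {U : Finset (Fin n)} {v : Fin n} (hv : v ∉ U) (hπv : π v ∉ U) :
    half π (insert v U) = insert v (half π U) := by
  ext u
  simp only [mem_half, mem_insert]
  constructor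
  · rintro ⟨hu, hπu⟩
    rcases hu with hu | hu
    · exact Or.inl hu
    · exact Or.inr ⟨hu, fun h => hπu (Or.inr h)⟩
  · rintro (hu | ⟨hu, hπu⟩)
    · subst hu
      exact ⟨Or.inl rfl, fun h => h.elim (fun h' => hπ' _ h') hπv⟩
    · refine ⟨Or.inr hu, fun h => h.elim (fun h' => hπv ?_) hπu⟩
      have : π (π u) = π v := by rw [h']
      rw [hπ] at this
      rw [← this]; exact hu

/-- Adding one endpoint of an edge outside `U` does not change the fully matched part.
[cite: Rothvoss2017, §2 (PDF p. 5)] -/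
theorem full_insert_of_notMem {U : Finset (Fin n)} {v : Fin n} (hv : v ∉ U) (hπv : π v ∉ U) :
    full π (insert v U) = full π U := by
  ext u
  simp only [mem_full, mem_insert]
  constructor
  · rintro ⟨hu, hπu⟩
    rcases hu with hu | hu
    · subst hu
      rcases hπu with h | h
      · exact absurd h (hπ' _)
      · exact absurd h hπv
    · rcases hπu with h | h
      · have : π (π u) = π v := by rw [h]
        rw [hπ] at this
        exact absurd hu (this ▸ hπv)
      · exact ⟨hu, h⟩
  · rintro ⟨hu, hπu⟩
    exact ⟨Or.inr hu, Or.inr hπu⟩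

omit hπ' in
/-- Adding a whole edge outside `U` does not change the half-matched part.
[cite: Rothvoss2017, §2 (PDF p. 5)] -/
theorem half_insert_insert_of_notMem {U : Finset (Fin n)} {v : Fin n} (hv : v ∉ U) (hπv : π v ∉ U) :
    half π (insert v (insert (π v) U)) = half π U := by
  ext u
  simp only [mem_half, mem_insert]
  constructor
  · rintro ⟨hu, hπu⟩
    rcases hu with hu | hu | hu
    · subst hu; exact absurd (Or.inr (Or.inl rfl)) hπu
    · have h1 : π u = v := by rw [hu, hπ]
      exact absurd (Or.inl h1) hπu
    · exact ⟨hu, fun h => hπu (Or.inr (Or.inr h))⟩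
  · rintro ⟨hu, hπu⟩
    refine ⟨Or.inr (Or.inr hu), ?_⟩
    rintro (h | h | h)
    · have : π (π u) = π v := by rw [h]
      rw [hπ] at this
      exact hπv (this ▸ hu)
    · have : π (π u) = π (π v) := by rw [h]
      rw [hπ, hπ] at this
      exact hv (this ▸ hu)
    · exact hπu h

omit hπ' in
/-- Adding a whole edge outside `U` adds its two endpoints to the fully matched part.
[cite: Rothvoss2017, §2 (PDF p. 5)] -/
theorem full_insert_insert_of_notMem {U : Finset (Fin n)} {v : Fin n} (hv : v ∉ U) (hπv : π v ∉ U) :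
    full π (insert v (insert (π v) U)) = insert v (insert (π v) (full π U)) := by
  ext u
  simp only [mem_full, mem_insert]
  constructor
  · rintro ⟨hu, hπu⟩
    rcases hu with hu | hu | hu
    · exact Or.inl hu
    · exact Or.inr (Or.inl hu)
    · refine Or.inr (Or.inr ⟨hu, ?_⟩)
      rcases hπu with h | h | h
      · have : π (π u) = π v := by rw [h]
        rw [hπ] at this
        exact absurd hu (this ▸ hπv)
      · have : π (π u) = π (π v) := by rw [h]
        rw [hπ, hπ] at this
        exact absurd hu (this ▸ hv)
      · exact h
  · rintro (hu | hu | ⟨hu, hπu⟩)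
    · subst hu; exact ⟨Or.inl rfl, Or.inr (Or.inl rfl)⟩
    · subst hu; exact ⟨Or.inr (Or.inl rfl), Or.inl (hπ v)⟩
    · exact ⟨Or.inr (Or.inr hu), Or.inr (Or.inr hπu)⟩

omit hπ hπ' in
/-- The block count of `U + v`. [cite: Rothvoss2017, §2 (PDF p. 5)] -/
theorem card_insert_inter (H : Finset (Fin n)) {U : Finset (Fin n)} {v : Fin n} (hv : v ∉ U) :
    (insert v U ∩ H).card = (U ∩ H).card + (if v ∈ H then 1 else 0) := by
  by_cases h : v ∈ H
  · rw [insert_inter_of_mem h, card_insert_of_notMem (fun h' => hv (mem_inter.1 h').1), if_pos h]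
  · rw [insert_inter_of_notMem h, if_neg h, add_zero]

/-! ### §2 The edge-product formula -/

/-- **One more edge.** For a `π`-stable `U`-universe `S₀` and an edge `{v, πv}` outside it, summing the
weight `X^{|U∩H|} Y^{|full U|} Z^{|half U|}` over the subsets of `S₀ ∪ {v, πv}` multiplies the sum over the
subsets of `S₀` by the edge factor `1 + Z·X^{[πv∈H]} + Z·X^{[v∈H]} + Y²·X^{[v∈H]+[πv∈H]}`.
[cite: Rothvoss2017, §2 (PDF p. 5)] -/
theorem shellGF_insert_insert {S₀ : Finset (Fin n)} (H : Finset (Fin n)) {v : Fin n} (hv : v ∉ S₀)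
    (hπv : π v ∉ S₀) :
    ∑ U ∈ (insert v (insert (π v) S₀)).powerset,
        Polynomial.C (Polynomial.C ((Polynomial.X : Polynomial ℝ) ^ (U ∩ H).card) *
          (Polynomial.X : Polynomial (Polynomial ℝ)) ^ (full π U).card) *
        (Polynomial.X : Polynomial (Polynomial (Polynomial ℝ))) ^ (half π U).card =
      (∑ U ∈ S₀.powerset,
        Polynomial.C (Polynomial.C ((Polynomial.X : Polynomial ℝ) ^ (U ∩ H).card) *
          (Polynomial.X : Polynomial (Polynomial ℝ)) ^ (full π U).card) *
        (Polynomial.X : Polynomial (Polynomial (Polynomial ℝ))) ^ (half π U).card) *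
      (1 + Polynomial.X * Polynomial.C (Polynomial.C ((Polynomial.X : Polynomial ℝ) ^ (if π v ∈ H then 1 else 0)))
         + Polynomial.X * Polynomial.C (Polynomial.C ((Polynomial.X : Polynomial ℝ) ^ (if v ∈ H then 1 else 0)))
         + Polynomial.C ((Polynomial.X : Polynomial (Polynomial ℝ)) ^ 2 *
             Polynomial.C ((Polynomial.X : Polynomial ℝ) ^ ((if v ∈ H then 1 else 0) + (if π v ∈ H then 1 else 0))))) := by
  have hvπ : v ≠ π v := fun h => hπ' v h.symm
  have hv' : v ∉ insert (π v) S₀ := by rw [mem_insert]; exact fun h => h.elim (fun h => hvπ h) hv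
  -- the three shifted sums
  have hA : ∑ U ∈ S₀.powerset,
      Polynomial.C (Polynomial.C ((Polynomial.X : Polynomial ℝ) ^ (insert (π v) U ∩ H).card) *
          (Polynomial.X : Polynomial (Polynomial ℝ)) ^ (full π (insert (π v) U)).card) *
        (Polynomial.X : Polynomial (Polynomial (Polynomial ℝ))) ^ (half π (insert (π v) U)).card =
      (∑ U ∈ S₀.powerset,
        Polynomial.C (Polynomial.C ((Polynomial.X : Polynomial ℝ) ^ (U ∩ H).card) *
          (Polynomial.X : Polynomial (Polynomial ℝ)) ^ (full π U).card) *
        (Polynomial.X : Polynomial (Polynomial (Polynomial ℝ))) ^ (half π U).card) *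
      (Polynomial.X * Polynomial.C (Polynomial.C ((Polynomial.X : Polynomial ℝ) ^ (if π v ∈ H then 1 else 0)))) := by
    rw [sum_mul]
    refine sum_congr rfl fun U hU => ?_
    have hUS : U ⊆ S₀ := mem_powerset.1 hU
    have h1 : π v ∉ U := fun h => hπv (hUS h)
    have h2 : π (π v) ∉ U := by rw [hπ]; exact fun h => hv (hUS h)
    rw [half_insert_of_notMem hπ hπ' h1 h2, full_insert_of_notMem hπ hπ' h1 h2,
      card_insert_of_notMem (fun h => h1 (mem_half.1 h).1), card_insert_inter H h1, pow_add, pow_succ]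
    simp only [map_mul, map_pow]
    ring
  have hB : ∑ U ∈ S₀.powerset,
      Polynomial.C (Polynomial.C ((Polynomial.X : Polynomial ℝ) ^ (insert v U ∩ H).card) *
          (Polynomial.X : Polynomial (Polynomial ℝ)) ^ (full π (insert v U)).card) *
        (Polynomial.X : Polynomial (Polynomial (Polynomial ℝ))) ^ (half π (insert v U)).card =
      (∑ U ∈ S₀.powerset,
        Polynomial.C (Polynomial.C ((Polynomial.X : Polynomial ℝ) ^ (U ∩ H).card) *
          (Polynomial.X : Polynomial (Polynomial ℝ)) ^ (full π U).card) *
        (Polynomial.X : Polynomial (Polynomial (Polynomial ℝ))) ^ (half π U).card) *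
      (Polynomial.X * Polynomial.C (Polynomial.C ((Polynomial.X : Polynomial ℝ) ^ (if v ∈ H then 1 else 0)))) := by
    rw [sum_mul]
    refine sum_congr rfl fun U hU => ?_
    have hUS : U ⊆ S₀ := mem_powerset.1 hU
    have h1 : v ∉ U := fun h => hv (hUS h)
    have h2 : π v ∉ U := fun h => hπv (hUS h)
    rw [half_insert_of_notMem hπ hπ' h1 h2, full_insert_of_notMem hπ hπ' h1 h2,
      card_insert_of_notMem (fun h => h1 (mem_half.1 h).1), card_insert_inter H h1, pow_add, pow_succ]
    simp only [map_mul, map_pow]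
    ring
  have hC : ∑ U ∈ S₀.powerset,
      Polynomial.C (Polynomial.C ((Polynomial.X : Polynomial ℝ) ^ (insert v (insert (π v) U) ∩ H).card) *
          (Polynomial.X : Polynomial (Polynomial ℝ)) ^ (full π (insert v (insert (π v) U))).card) *
        (Polynomial.X : Polynomial (Polynomial (Polynomial ℝ))) ^ (half π (insert v (insert (π v) U))).card =
      (∑ U ∈ S₀.powerset,
        Polynomial.C (Polynomial.C ((Polynomial.X : Polynomial ℝ) ^ (U ∩ H).card) *
          (Polynomial.X : Polynomial (Polynomial ℝ)) ^ (full π U).card) *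
        (Polynomial.X : Polynomial (Polynomial (Polynomial ℝ))) ^ (half π U).card) *
      Polynomial.C ((Polynomial.X : Polynomial (Polynomial ℝ)) ^ 2 *
        Polynomial.C ((Polynomial.X : Polynomial ℝ) ^ ((if v ∈ H then 1 else 0) + (if π v ∈ H then 1 else 0)))) := by
    rw [sum_mul]
    refine sum_congr rfl fun U hU => ?_
    have hUS : U ⊆ S₀ := mem_powerset.1 hU
    have h1 : v ∉ U := fun h => hv (hUS h)
    have h2 : π v ∉ U := fun h => hπv (hUS h)
    have h3 : v ∉ insert (π v) U := by rw [mem_insert]; exact fun h => h.elim (fun h => hvπ h) h1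
    rw [half_insert_insert_of_notMem hπ h1 h2, full_insert_insert_of_notMem hπ h1 h2,
      card_insert_of_notMem (by rw [mem_insert, mem_full]; exact fun h => h.elim (fun h => hvπ h) fun h => h1 h.1),
      card_insert_of_notMem (fun h => h2 (mem_full.1 h).1), card_insert_inter H h3, card_insert_inter H h2,
      pow_add, pow_add, pow_add, pow_succ, pow_succ]
    simp only [map_mul, map_pow]
    ring
  rw [sum_powerset_insert hv', sum_powerset_insert hπv, sum_powerset_insert hπv, hA, hB, hC]
  ring

/-- **The edge-product formula.** For representatives `R` (`v < πv` for `v ∈ R`) of a set of edges,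
`Σ_{U ⊆ R ∪ πR} X^{|U∩H|} Y^{|full U|} Z^{|half U|} = Π_{v ∈ R} (1 + Z·X^{[πv∈H]} + Z·X^{[v∈H]} + Y²·X^{[v∈H]+[πv∈H]})`.
[cite: Rothvoss2017, §2 (PDF p. 5)] [cite: GodsilMeagher2015, §15.2] -/
theorem shellGF_close_eq_prod (H : Finset (Fin n)) {R : Finset (Fin n)} (hR : ∀ v ∈ R, v < π v) :
    ∑ U ∈ (close π R).powerset,
        Polynomial.C (Polynomial.C ((Polynomial.X : Polynomial ℝ) ^ (U ∩ H).card) *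
          (Polynomial.X : Polynomial (Polynomial ℝ)) ^ (full π U).card) *
        (Polynomial.X : Polynomial (Polynomial (Polynomial ℝ))) ^ (half π U).card =
      ∏ v ∈ R, (1 + Polynomial.X * Polynomial.C (Polynomial.C ((Polynomial.X : Polynomial ℝ) ^ (if π v ∈ H then 1 else 0)))
         + Polynomial.X * Polynomial.C (Polynomial.C ((Polynomial.X : Polynomial ℝ) ^ (if v ∈ H then 1 else 0)))
         + Polynomial.C ((Polynomial.X : Polynomial (Polynomial ℝ)) ^ 2 *
             Polynomial.C ((Polynomial.X : Polynomial ℝ) ^ ((if v ∈ H then 1 else 0) + (if π v ∈ H then 1 else 0))))) := by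
  classical
  induction R using Finset.induction_on with
  | empty =>
    rw [prod_empty]
    have : close π (∅ : Finset (Fin n)) = ∅ := by
      ext v; rw [mem_close hπ]; simp
    rw [this, powerset_empty, sum_singleton]
    simp [half, full]
  | insert v R hvR ih =>
    have hR' : ∀ w ∈ R, w < π w := fun w hw => hR w (mem_insert_of_mem hw)
    have hvlt : v < π v := hR v (mem_insert_self v R)
    -- `v` and `πv` are outside `close R`
    have hv : v ∉ close π R := by
      rw [mem_close hπ]
      rintro (h | h)
      · exact hvR h
      · have := hR' _ h; rw [hπ] at this; exact absurd (hvlt.trans this) (lt_irrefl _)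
    have hπv : π v ∉ close π R := by
      rw [mem_close hπ, hπ]
      rintro (h | h)
      · have := hR' _ h; rw [hπ] at this; exact absurd (hvlt.trans this) (lt_irrefl _)
      · exact hvR h
    have hclose : close π (insert v R) = insert v (insert (π v) (close π R)) := by
      ext u; simp only [mem_close hπ, mem_insert]
      constructor
      · rintro ((rfl | hu) | (h | hu))
        · exact Or.inl rfl
        · exact Or.inr (Or.inr (Or.inl hu))
        · exact Or.inr (Or.inl (by rw [← h, hπ]))
        · exact Or.inr (Or.inr (Or.inr hu))
      · rintro (rfl | rfl | (hu | hu))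
        · exact Or.inl (Or.inl rfl)
        · exact Or.inr (Or.inl (by rw [hπ]))
        · exact Or.inl (Or.inr hu)
        · exact Or.inr (Or.inr hu)
    rw [hclose, shellGF_insert_insert hπ hπ' H hv hπv, ih hR', prod_insert hvR]
    ring

/-- Every `π`-stable ground set is the closure of its representatives, so the edge-product formula reads
`Σ_{U ⊆ S} X^{|U∩H|} Y^{|full U|} Z^{|half U|} = Π_{v ∈ reps S} (edge factor at v)`.
[cite: Rothvoss2017, §2 (PDF p. 5)] [cite: GodsilMeagher2015, §15.2] -/
theorem shellGF_eq_prod {S : Finset (Fin n)} (hS : ∀ v ∈ S, π v ∈ S) (H : Finset (Fin n)) :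
    ∑ U ∈ S.powerset,
        Polynomial.C (Polynomial.C ((Polynomial.X : Polynomial ℝ) ^ (U ∩ H).card) *
          (Polynomial.X : Polynomial (Polynomial ℝ)) ^ (full π U).card) *
        (Polynomial.X : Polynomial (Polynomial (Polynomial ℝ))) ^ (half π U).card =
      ∏ v ∈ reps π S, (1 + Polynomial.X * Polynomial.C (Polynomial.C ((Polynomial.X : Polynomial ℝ) ^ (if π v ∈ H then 1 else 0)))
         + Polynomial.X * Polynomial.C (Polynomial.C ((Polynomial.X : Polynomial ℝ) ^ (if v ∈ H then 1 else 0)))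
         + Polynomial.C ((Polynomial.X : Polynomial (Polynomial ℝ)) ^ 2 *
             Polynomial.C ((Polynomial.X : Polynomial ℝ) ^ ((if v ∈ H then 1 else 0) + (if π v ∈ H then 1 else 0))))) := by
  conv_lhs => rw [← close_reps hπ hπ' hS]
  exact shellGF_close_eq_prod hπ hπ' H fun v hv => (mem_reps.1 hv).2

/-! ### §3 Grouping the edges by type: `Ψ_S = A^a · B^b · D^d` -/

/-- **`Ψ_S = A^a·B^b·D^d`** with `A = 1 + 2ZX + Y²X²` (per `HH` edge), `B = 1 + Z + ZX + Y²X` (per mixed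
edge), `D = 1 + 2Z + Y²` (per `H̄H̄` edge), `a = |reps AA|`, `b = |reps(BH ∪ BN)|`, `d = |reps DD|`.
[cite: Rothvoss2017, §2 (PDF p. 5)] -/
theorem shellGF_eq_pow_mul_pow_mul_pow {S : Finset (Fin n)} (hS : ∀ v ∈ S, π v ∈ S) (H : Finset (Fin n)) :
    ∑ U ∈ S.powerset,
        Polynomial.C (Polynomial.C ((Polynomial.X : Polynomial ℝ) ^ (U ∩ H).card) *
          (Polynomial.X : Polynomial (Polynomial ℝ)) ^ (full π U).card) *
        (Polynomial.X : Polynomial (Polynomial (Polynomial ℝ))) ^ (half π U).card =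
      (1 + 2 * Polynomial.X * Polynomial.C (Polynomial.C (Polynomial.X : Polynomial ℝ)) +
          Polynomial.C ((Polynomial.X : Polynomial (Polynomial ℝ)) ^ 2 *
            Polynomial.C ((Polynomial.X : Polynomial ℝ) ^ 2))) ^ (reps π (vAA π S H)).card *
      (1 + Polynomial.X + Polynomial.X * Polynomial.C (Polynomial.C (Polynomial.X : Polynomial ℝ)) +
          Polynomial.C ((Polynomial.X : Polynomial (Polynomial ℝ)) ^ 2 *
            Polynomial.C (Polynomial.X : Polynomial ℝ))) ^ (reps π (vBH π S H ∪ vBN π S H)).card *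
      (1 + 2 * Polynomial.X + Polynomial.C ((Polynomial.X : Polynomial (Polynomial ℝ)) ^ 2)) ^
        (reps π (vDD π S H)).card := by
  rw [shellGF_eq_prod hπ hπ' hS H]
  -- split `reps S` into the three type classes
  have hsplit : reps π S = reps π (vAA π S H) ∪ reps π (vBH π S H ∪ vBN π S H) ∪ reps π (vDD π S H) := by
    ext v
    simp only [mem_union, mem_reps, mem_vAA, mem_vBH, mem_vBN, mem_vDD]
    constructor
    · rintro ⟨hvS, hlt⟩
      by_cases h1 : v ∈ H
      · by_cases h2 : π v ∈ H
        · exact Or.inl (Or.inl ⟨⟨hvS, h1, h2⟩, hlt⟩)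
        · exact Or.inl (Or.inr ⟨Or.inl ⟨hvS, h1, h2⟩, hlt⟩)
      · by_cases h2 : π v ∈ H
        · exact Or.inl (Or.inr ⟨Or.inr ⟨hvS, h1, h2⟩, hlt⟩)
        · exact Or.inr ⟨⟨hvS, h1, h2⟩, hlt⟩
    · rintro ((⟨⟨hvS, _, _⟩, hlt⟩ | ⟨h, hlt⟩) | ⟨⟨hvS, _, _⟩, hlt⟩)
      · exact ⟨hvS, hlt⟩
      · rcases h with ⟨hvS, _, _⟩ | ⟨hvS, _, _⟩ <;> exact ⟨hvS, hlt⟩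
      · exact ⟨hvS, hlt⟩
  have hdAB : Disjoint (reps π (vAA π S H)) (reps π (vBH π S H ∪ vBN π S H)) := by
    rw [disjoint_left]; intro v h1 h2
    rw [mem_reps, mem_vAA] at h1; rw [mem_reps, mem_union, mem_vBH, mem_vBN] at h2
    rcases h2.1 with h | h
    · exact h.2.2 h1.1.2.2
    · exact h.2.1 h1.1.2.1
  have hdABD : Disjoint (reps π (vAA π S H) ∪ reps π (vBH π S H ∪ vBN π S H)) (reps π (vDD π S H)) := by
    rw [disjoint_left]; intro v h1 h2
    rw [mem_reps, mem_vDD] at h2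
    rcases mem_union.1 h1 with h | h
    · rw [mem_reps, mem_vAA] at h; exact h2.1.2.1 h.1.2.1
    · rw [mem_reps, mem_union, mem_vBH, mem_vBN] at h
      rcases h.1 with h' | h'
      · exact h2.1.2.1 h'.2.1
      · exact h2.1.2.2 h'.2.2
  rw [hsplit, prod_union hdABD, prod_union hdAB]
  have eAA : ∀ v ∈ reps π (vAA π S H),
      (1 + Polynomial.X * Polynomial.C (Polynomial.C ((Polynomial.X : Polynomial ℝ) ^ (if π v ∈ H then 1 else 0)))
         + Polynomial.X * Polynomial.C (Polynomial.C ((Polynomial.X : Polynomial ℝ) ^ (if v ∈ H then 1 else 0)))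
         + Polynomial.C ((Polynomial.X : Polynomial (Polynomial ℝ)) ^ 2 *
             Polynomial.C ((Polynomial.X : Polynomial ℝ) ^ ((if v ∈ H then 1 else 0) + (if π v ∈ H then 1 else 0))))
        : Polynomial (Polynomial (Polynomial ℝ))) =
      1 + 2 * Polynomial.X * Polynomial.C (Polynomial.C (Polynomial.X : Polynomial ℝ)) +
          Polynomial.C ((Polynomial.X : Polynomial (Polynomial ℝ)) ^ 2 *
            Polynomial.C ((Polynomial.X : Polynomial ℝ) ^ 2)) := by
    intro v hv
    obtain ⟨_, h1, h2⟩ := mem_vAA.1 (mem_reps.1 hv).1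
    rw [if_pos h1, if_pos h2, pow_one]
    ring
  have eB : ∀ v ∈ reps π (vBH π S H ∪ vBN π S H),
      (1 + Polynomial.X * Polynomial.C (Polynomial.C ((Polynomial.X : Polynomial ℝ) ^ (if π v ∈ H then 1 else 0)))
         + Polynomial.X * Polynomial.C (Polynomial.C ((Polynomial.X : Polynomial ℝ) ^ (if v ∈ H then 1 else 0)))
         + Polynomial.C ((Polynomial.X : Polynomial (Polynomial ℝ)) ^ 2 *
             Polynomial.C ((Polynomial.X : Polynomial ℝ) ^ ((if v ∈ H then 1 else 0) + (if π v ∈ H then 1 else 0))))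
        : Polynomial (Polynomial (Polynomial ℝ))) =
      1 + Polynomial.X + Polynomial.X * Polynomial.C (Polynomial.C (Polynomial.X : Polynomial ℝ)) +
          Polynomial.C ((Polynomial.X : Polynomial (Polynomial ℝ)) ^ 2 *
            Polynomial.C (Polynomial.X : Polynomial ℝ)) := by
    intro v hv
    rcases mem_union.1 (mem_reps.1 hv).1 with h | h
    · obtain ⟨_, h1, h2⟩ := mem_vBH.1 h
      rw [if_pos h1, if_neg h2]
      simp only [pow_zero, pow_one, add_zero, map_one, mul_one]
    · obtain ⟨_, h1, h2⟩ := mem_vBN.1 h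
      rw [if_neg h1, if_pos h2]
      simp only [pow_zero, pow_one, zero_add, map_one, mul_one]
      ring
  have eDD : ∀ v ∈ reps π (vDD π S H),
      (1 + Polynomial.X * Polynomial.C (Polynomial.C ((Polynomial.X : Polynomial ℝ) ^ (if π v ∈ H then 1 else 0)))
         + Polynomial.X * Polynomial.C (Polynomial.C ((Polynomial.X : Polynomial ℝ) ^ (if v ∈ H then 1 else 0)))
         + Polynomial.C ((Polynomial.X : Polynomial (Polynomial ℝ)) ^ 2 *
             Polynomial.C ((Polynomial.X : Polynomial ℝ) ^ ((if v ∈ H then 1 else 0) + (if π v ∈ H then 1 else 0))))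
        : Polynomial (Polynomial (Polynomial ℝ))) =
      1 + 2 * Polynomial.X + Polynomial.C ((Polynomial.X : Polynomial (Polynomial ℝ)) ^ 2) := by
    intro v hv
    obtain ⟨_, h1, h2⟩ := mem_vDD.1 (mem_reps.1 hv).1
    rw [if_neg h1, if_neg h2]
    simp only [add_zero, pow_zero, map_one, mul_one]
    ring
  rw [prod_congr rfl eAA, prod_congr rfl eB, prod_congr rfl eDD, prod_const, prod_const, prod_const]

/-! ### §4 The TYPE STEP: `A·D − B² = (Y² − Z²)(1 − X)²` -/

omit hπ hπ' in
/-- **The type-step factor**: `A·D − B² = (Y² − Z²)·(1 − X)²`. [cite: Rothvoss2017, §2 (PDF p. 6)] -/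
theorem typeStep_factor :
    ((1 + 2 * Polynomial.X * Polynomial.C (Polynomial.C (Polynomial.X : Polynomial ℝ)) +
          Polynomial.C ((Polynomial.X : Polynomial (Polynomial ℝ)) ^ 2 *
            Polynomial.C ((Polynomial.X : Polynomial ℝ) ^ 2))) : Polynomial (Polynomial (Polynomial ℝ))) * (1 + 2 * Polynomial.X + Polynomial.C ((Polynomial.X : Polynomial (Polynomial ℝ)) ^ 2)) - (1 + Polynomial.X + Polynomial.X * Polynomial.C (Polynomial.C (Polynomial.X : Polynomial ℝ)) +
          Polynomial.C ((Polynomial.X : Polynomial (Polynomial ℝ)) ^ 2 *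
            Polynomial.C (Polynomial.X : Polynomial ℝ))) ^ 2 =
      ((Polynomial.C ((Polynomial.X : Polynomial (Polynomial ℝ)) ^ 2) - Polynomial.X ^ 2) *
        Polynomial.C (Polynomial.C ((1 - (Polynomial.X : Polynomial ℝ)) ^ 2))) := by
  simp only [map_mul, map_pow, map_sub, map_one]
  ring

/-- **The TYPE STEP for generating functions**: if `S₁`, `S₂`, `S₀` are `π`-stable ground sets of
`H`-types `(a+1, b, d+1)`, `(a, b+2, d)`, `(a, b, d)` (one `HH` and one `H̄H̄` edge traded for two mixed
edges), then `Ψ_{S₁} − Ψ_{S₂} = Ψ_{S₀} · (Y² − Z²)(1 − X)²`. [cite: Rothvoss2017, §2 (PDF p. 6)] -/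
theorem shellGF_typeStep {S₁ S₂ S₀ : Finset (Fin n)} (hS₁ : ∀ v ∈ S₁, π v ∈ S₁) (hS₂ : ∀ v ∈ S₂, π v ∈ S₂)
    (hS₀ : ∀ v ∈ S₀, π v ∈ S₀) (H : Finset (Fin n))
    (haa : (reps π (vAA π S₁ H)).card = (reps π (vAA π S₀ H)).card + 1)
    (hab : (reps π (vBH π S₁ H ∪ vBN π S₁ H)).card = (reps π (vBH π S₀ H ∪ vBN π S₀ H)).card)
    (had : (reps π (vDD π S₁ H)).card = (reps π (vDD π S₀ H)).card + 1)
    (hba : (reps π (vAA π S₂ H)).card = (reps π (vAA π S₀ H)).card)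
    (hbb : (reps π (vBH π S₂ H ∪ vBN π S₂ H)).card = (reps π (vBH π S₀ H ∪ vBN π S₀ H)).card + 2)
    (hbd : (reps π (vDD π S₂ H)).card = (reps π (vDD π S₀ H)).card) :
    (∑ U ∈ S₁.powerset, Polynomial.C (Polynomial.C ((Polynomial.X : Polynomial ℝ) ^ (U ∩ H).card) *
          (Polynomial.X : Polynomial (Polynomial ℝ)) ^ (full π U).card) *
        (Polynomial.X : Polynomial (Polynomial (Polynomial ℝ))) ^ (half π U).card) -
      (∑ U ∈ S₂.powerset, Polynomial.C (Polynomial.C ((Polynomial.X : Polynomial ℝ) ^ (U ∩ H).card) *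
          (Polynomial.X : Polynomial (Polynomial ℝ)) ^ (full π U).card) *
        (Polynomial.X : Polynomial (Polynomial (Polynomial ℝ))) ^ (half π U).card) =
      (∑ U ∈ S₀.powerset, Polynomial.C (Polynomial.C ((Polynomial.X : Polynomial ℝ) ^ (U ∩ H).card) *
          (Polynomial.X : Polynomial (Polynomial ℝ)) ^ (full π U).card) *
        (Polynomial.X : Polynomial (Polynomial (Polynomial ℝ))) ^ (half π U).card) *
      ((Polynomial.C ((Polynomial.X : Polynomial (Polynomial ℝ)) ^ 2) - Polynomial.X ^ 2) *
        Polynomial.C (Polynomial.C ((1 - (Polynomial.X : Polynomial ℝ)) ^ 2))) := by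
  rw [shellGF_eq_pow_mul_pow_mul_pow hπ hπ' hS₁ H, shellGF_eq_pow_mul_pow_mul_pow hπ hπ' hS₂ H,
    shellGF_eq_pow_mul_pow_mul_pow hπ hπ' hS₀ H, haa, hab, had, hba, hbb, hbd, ← typeStep_factor]
  ring

/-! ### §5 Coefficient extraction: `[Z^c][Y^f] Ψ_S = G_S(f+c, c)` -/

omit hπ hπ' in
/-- A cut has at least as many vertices as half-matched vertices: `Shell_S(t,c) = ∅` for `t < c`.
[cite: Rothvoss2017, §2 (PDF p. 6)] -/
theorem shellIn_eq_empty_of_lt (S : Finset (Fin n)) {t c : ℕ} (h : t < c) : shellIn π S t c = ∅ := by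
  refine filter_eq_empty_iff.2 fun U _ hU => ?_
  have := card_le_card (show half π U ⊆ U from filter_subset _ _)
  omega

omit hπ hπ' in
/-- **Coefficient extraction**: the `Z^c Y^f` coefficient of `Ψ_S` is the shell generating polynomial
`G_S(f+c, c) = Σ_{U ∈ Shell_S(f+c,c)} X^{|U∩H|}` (the cuts with `c` half-matched and `f` fully matched
vertices). [cite: Rothvoss2017, §2 (PDF p. 6)] -/
theorem coeff_coeff_shellGF (S H : Finset (Fin n)) (c f : ℕ) :
    ((∑ U ∈ S.powerset, Polynomial.C (Polynomial.C ((Polynomial.X : Polynomial ℝ) ^ (U ∩ H).card) *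
          (Polynomial.X : Polynomial (Polynomial ℝ)) ^ (full π U).card) *
        (Polynomial.X : Polynomial (Polynomial (Polynomial ℝ))) ^ (half π U).card).coeff c).coeff f =
      ∑ U ∈ shellIn π S (f + c) c, (Polynomial.X : Polynomial ℝ) ^ (U ∩ H).card := by
  rw [finsetSum_coeff, finsetSum_coeff]
  simp only [coeff_C_mul_X_pow]
  rw [shellIn, sum_filter]
  refine sum_congr rfl fun U _ => ?_
  have hfh := card_full_add_card_half (π := π) U
  by_cases hc : c = (half π U).card
  · rw [if_pos hc, coeff_C_mul_X_pow]
    by_cases hf : f = (full π U).card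
    · rw [if_pos hf, if_pos ⟨by omega, hc.symm⟩]
    · rw [if_neg hf, if_neg (by omega)]
  · rw [if_neg hc, coeff_zero, if_neg (fun h => hc h.2.symm)]

/-! ### §6 Consequences in shell language: the law depends only on the type; the TYPE STEP -/

/-- **The shell generating polynomial depends on the ground set only through its `H`-type**: two
`π`-stable ground sets with the same numbers of `HH`, mixed and `H̄H̄` edges have the same
`G(t,c) = Σ_{U ∈ Shell(t,c)} X^{|U∩H|}` for all `t, c` (hence the same shell sizes and shell laws).
[cite: Rothvoss2017, §2 (PDF p. 6)] -/
theorem shellGen_eq_of_type_eq {S₁ S₂ : Finset (Fin n)} (hS₁ : ∀ v ∈ S₁, π v ∈ S₁) (hS₂ : ∀ v ∈ S₂, π v ∈ S₂)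
    (H : Finset (Fin n)) (ha : (reps π (vAA π S₁ H)).card = (reps π (vAA π S₂ H)).card)
    (hb : (reps π (vBH π S₁ H ∪ vBN π S₁ H)).card = (reps π (vBH π S₂ H ∪ vBN π S₂ H)).card)
    (hd : (reps π (vDD π S₁ H)).card = (reps π (vDD π S₂ H)).card) (t c : ℕ) :
    ∑ U ∈ shellIn π S₁ t c, (Polynomial.X : Polynomial ℝ) ^ (U ∩ H).card =
      ∑ U ∈ shellIn π S₂ t c, (Polynomial.X : Polynomial ℝ) ^ (U ∩ H).card := by
  rcases Nat.lt_or_ge t c with htc | htc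
  · rw [shellIn_eq_empty_of_lt S₁ htc, shellIn_eq_empty_of_lt S₂ htc]
  · obtain ⟨f, rfl⟩ : ∃ f, t = f + c := ⟨t - c, by omega⟩
    rw [← coeff_coeff_shellGF S₁ H c f, ← coeff_coeff_shellGF S₂ H c f,
      shellGF_eq_pow_mul_pow_mul_pow hπ hπ' hS₁ H, shellGF_eq_pow_mul_pow_mul_pow hπ hπ' hS₂ H, ha, hb, hd]

/-- **The TYPE STEP for shell generating polynomials** (eng g20, 2026-08-28): for `π`-stable ground sets
`S₁, S₂, S₀` of `H`-types `(a+1,b,d+1)`, `(a,b+2,d)`, `(a,b,d)` and every `c, f`,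
`G_{S₁}(f+c,c) − G_{S₂}(f+c,c) = (1−X)²·([f ≥ 2]·G_{S₀}((f−2)+c, c) − [c ≥ 2]·G_{S₀}(f+(c−2), c−2))`:
trading an `HH` and an `H̄H̄` edge for two mixed edges changes the shell count by a SECOND
`x`-DIFFERENCE of the counts of the common remainder with one full edge fewer, minus those with two
half vertices fewer. [cite: Rothvoss2017, §2 (PDF p. 6)] -/
theorem shellGen_typeStep {S₁ S₂ S₀ : Finset (Fin n)} (hS₁ : ∀ v ∈ S₁, π v ∈ S₁) (hS₂ : ∀ v ∈ S₂, π v ∈ S₂)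
    (hS₀ : ∀ v ∈ S₀, π v ∈ S₀) (H : Finset (Fin n))
    (haa : (reps π (vAA π S₁ H)).card = (reps π (vAA π S₀ H)).card + 1)
    (hab : (reps π (vBH π S₁ H ∪ vBN π S₁ H)).card = (reps π (vBH π S₀ H ∪ vBN π S₀ H)).card)
    (had : (reps π (vDD π S₁ H)).card = (reps π (vDD π S₀ H)).card + 1)
    (hba : (reps π (vAA π S₂ H)).card = (reps π (vAA π S₀ H)).card)
    (hbb : (reps π (vBH π S₂ H ∪ vBN π S₂ H)).card = (reps π (vBH π S₀ H ∪ vBN π S₀ H)).card + 2)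
    (hbd : (reps π (vDD π S₂ H)).card = (reps π (vDD π S₀ H)).card) (c f : ℕ) :
    (∑ U ∈ shellIn π S₁ (f + c) c, (Polynomial.X : Polynomial ℝ) ^ (U ∩ H).card) -
      (∑ U ∈ shellIn π S₂ (f + c) c, (Polynomial.X : Polynomial ℝ) ^ (U ∩ H).card) =
      (1 - Polynomial.X) ^ 2 *
        ((if 2 ≤ f then ∑ U ∈ shellIn π S₀ (f - 2 + c) c, (Polynomial.X : Polynomial ℝ) ^ (U ∩ H).card else 0) -
          (if 2 ≤ c then ∑ U ∈ shellIn π S₀ (f + (c - 2)) (c - 2), (Polynomial.X : Polynomial ℝ) ^ (U ∩ H).card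
            else 0)) := by
  have h := shellGF_typeStep hπ hπ' hS₁ hS₂ hS₀ H haa hab had hba hbb hbd
  have hcf := congrArg (fun P : Polynomial (Polynomial (Polynomial ℝ)) => (P.coeff c).coeff f) h
  simp only [coeff_sub] at hcf
  rw [coeff_coeff_shellGF, coeff_coeff_shellGF] at hcf
  rw [hcf]
  -- extract the coefficient of the right-hand side
  have key : (∑ U ∈ S₀.powerset, Polynomial.C (Polynomial.C ((Polynomial.X : Polynomial ℝ) ^ (U ∩ H).card) *
          (Polynomial.X : Polynomial (Polynomial ℝ)) ^ (full π U).card) *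
        (Polynomial.X : Polynomial (Polynomial (Polynomial ℝ))) ^ (half π U).card) *
      ((Polynomial.C ((Polynomial.X : Polynomial (Polynomial ℝ)) ^ 2) - Polynomial.X ^ 2) *
        Polynomial.C (Polynomial.C ((1 - (Polynomial.X : Polynomial ℝ)) ^ 2))) =
      (∑ U ∈ S₀.powerset, Polynomial.C (Polynomial.C ((Polynomial.X : Polynomial ℝ) ^ (U ∩ H).card) *
          (Polynomial.X : Polynomial (Polynomial ℝ)) ^ (full π U).card) *
        (Polynomial.X : Polynomial (Polynomial (Polynomial ℝ))) ^ (half π U).card) *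
        (Polynomial.C ((Polynomial.X : Polynomial (Polynomial ℝ)) ^ 2) *
          Polynomial.C (Polynomial.C ((1 - (Polynomial.X : Polynomial ℝ)) ^ 2))) -
      (∑ U ∈ S₀.powerset, Polynomial.C (Polynomial.C ((Polynomial.X : Polynomial ℝ) ^ (U ∩ H).card) *
          (Polynomial.X : Polynomial (Polynomial ℝ)) ^ (full π U).card) *
        (Polynomial.X : Polynomial (Polynomial (Polynomial ℝ))) ^ (half π U).card) *
        Polynomial.C (Polynomial.C ((1 - (Polynomial.X : Polynomial ℝ)) ^ 2)) * Polynomial.X ^ 2 := by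
    ring
  rw [key, coeff_sub, coeff_sub]
  have e1 : (((∑ U ∈ S₀.powerset, Polynomial.C (Polynomial.C ((Polynomial.X : Polynomial ℝ) ^ (U ∩ H).card) *
          (Polynomial.X : Polynomial (Polynomial ℝ)) ^ (full π U).card) *
        (Polynomial.X : Polynomial (Polynomial (Polynomial ℝ))) ^ (half π U).card) *
      (Polynomial.C ((Polynomial.X : Polynomial (Polynomial ℝ)) ^ 2) *
        Polynomial.C (Polynomial.C ((1 - (Polynomial.X : Polynomial ℝ)) ^ 2)))).coeff c).coeff f =
      if 2 ≤ f then ((1 - Polynomial.X) ^ 2 *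
        ∑ U ∈ shellIn π S₀ (f - 2 + c) c, (Polynomial.X : Polynomial ℝ) ^ (U ∩ H).card) else 0 := by
    rw [← map_mul, coeff_mul_C, show (Polynomial.X : Polynomial (Polynomial ℝ)) ^ 2 *
        Polynomial.C ((1 - (Polynomial.X : Polynomial ℝ)) ^ 2) =
        Polynomial.C ((1 - (Polynomial.X : Polynomial ℝ)) ^ 2) * Polynomial.X ^ 2 by rw [mul_comm],
      ← mul_assoc, coeff_mul_X_pow', coeff_mul_C]
    split_ifs with hf
    · rw [coeff_coeff_shellGF, mul_comm]
    · rfl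
  have e2 : (((∑ U ∈ S₀.powerset, Polynomial.C (Polynomial.C ((Polynomial.X : Polynomial ℝ) ^ (U ∩ H).card) *
          (Polynomial.X : Polynomial (Polynomial ℝ)) ^ (full π U).card) *
        (Polynomial.X : Polynomial (Polynomial (Polynomial ℝ))) ^ (half π U).card) *
      Polynomial.C (Polynomial.C ((1 - (Polynomial.X : Polynomial ℝ)) ^ 2)) * Polynomial.X ^ 2).coeff c).coeff f =
      if 2 ≤ c then ((1 - Polynomial.X) ^ 2 *
        ∑ U ∈ shellIn π S₀ (f + (c - 2)) (c - 2), (Polynomial.X : Polynomial ℝ) ^ (U ∩ H).card) else 0 := by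
    rw [coeff_mul_X_pow']
    split_ifs with hc
    · rw [coeff_mul_C, coeff_mul_C, coeff_coeff_shellGF, mul_comm]
    · rw [coeff_zero]
  rw [e1, e2]
  split_ifs <;> ring

/-! ### §7 Pinning full edges: tilted block statistics are shifted, deleted shell laws

For the TILTED masks `ψ(|U ∩ H|)·x_p x_{πp} x_q x_{πq}` (`x = 𝟙_U`; LIT-44 §7, MEMO-24 §3(a)) one pins the
full edges `e_p, e_q ⊆ U`: `U ↦ U ∖ e` is a bijection from the cuts of `Shell_S(t+2,c)` containing the
edge `e` onto `Shell_{S∖e}(t,c)`, the block count drops by `|e ∩ H|`, and the pinned fraction of the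
shell is `(t+2−c)/|S|` (one edge) resp. `(t+4−c)(t+2−c)/(|S|(|S|−2))` (two edges) — a polynomial of
degree `≤ 2` in the level `c` times a deleted shell law, so the level differences of a tilted block
statistic are, by the Leibniz rule, level differences of orders `m−2 … m` of deleted shell laws of a
shifted block statistic. -/

/-- **Pinning one full edge is deleting it** (sum form): for `v ∈ S`,
`Σ_{U ∈ Shell_S(t+2,c), v,πv ∈ U} g(U) = Σ_{W ∈ Shell_{S∖{v,πv}}(t,c)} g(W ∪ {v,πv})` via `W = U ∖ {v,πv}`.
[cite: Rothvoss2017, §2 (PDF p. 6)] -/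
theorem sum_shellIn_full_eq {S : Finset (Fin n)} (hS : ∀ v ∈ S, π v ∈ S) {v : Fin n} (hv : v ∈ S)
    (t c : ℕ) (g : Finset (Fin n) → ℝ) :
    ∑ U ∈ (shellIn π S (t + 2) c).filter (fun U => v ∈ U ∧ π v ∈ U), g U =
      ∑ W ∈ shellIn π (S \ {v, π v}) t c, g (W ∪ {v, π v}) := by
  have hPcard : ({v, π v} : Finset (Fin n)).card = 2 := card_pair (hπ' v).symm
  have hPsub : ∀ {U : Finset (Fin n)}, v ∈ U → π v ∈ U → ({v, π v} : Finset (Fin n)) ⊆ U :=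
    fun hvU hπvU u hu => by
      rcases mem_insert.1 hu with rfl | h
      · exact hvU
      · rw [mem_singleton] at h; subst h; exact hπvU
  have hW : ∀ {W : Finset (Fin n)}, W ⊆ S \ {v, π v} → v ∉ W ∧ π v ∉ W ∧ Disjoint W {v, π v} := by
    intro W hWS
    have hvW : v ∉ W := fun h => by have := mem_sdiff.1 (hWS h); simp at this
    have hπvW : π v ∉ W := fun h => by have := mem_sdiff.1 (hWS h); simp at this
    exact ⟨hvW, hπvW, disjoint_left.2 fun u huW huP => by
      rcases mem_insert.1 huP with rfl | h
      · exact hvW huW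
      · rw [mem_singleton] at h; subst h; exact hπvW huW⟩
  refine sum_nbij' (fun U => U \ {v, π v}) (fun W => W ∪ {v, π v}) ?_ ?_ ?_ ?_ ?_
  · intro U hU
    simp only [mem_filter, mem_shellIn] at hU ⊢
    obtain ⟨⟨hUS, hUt, hUc⟩, hvU, hπvU⟩ := hU
    refine ⟨sdiff_subset_sdiff hUS le_rfl, ?_, ?_⟩
    · rw [card_sdiff_of_subset (hPsub hvU hπvU), hUt, hPcard]; rfl
    · rw [half_sdiff_pair hπ hvU hπvU, hUc]
  · intro W hW'
    simp only [mem_filter, mem_shellIn] at hW' ⊢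
    obtain ⟨hWS, hWt, hWc⟩ := hW'
    obtain ⟨_, _, hdisj⟩ := hW hWS
    have hvU : v ∈ W ∪ {v, π v} := mem_union_right _ (mem_insert_self _ _)
    have hπvU : π v ∈ W ∪ {v, π v} :=
      mem_union_right _ (mem_insert_of_mem (mem_singleton_self _))
    refine ⟨⟨?_, ?_, ?_⟩, hvU, hπvU⟩
    · intro u hu
      rcases mem_union.1 hu with h | h
      · exact (mem_sdiff.1 (hWS h)).1
      · rcases mem_insert.1 h with rfl | h
        · exact hv
        · rw [mem_singleton] at h; subst h; exact hS _ hv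
    · rw [card_union_of_disjoint hdisj, hWt, hPcard]
    · have e : (W ∪ {v, π v}) \ {v, π v} = W := by
        rw [union_sdiff_right, sdiff_eq_self_of_disjoint hdisj]
      rw [← half_sdiff_pair hπ hvU hπvU, e, hWc]
  · intro U hU
    simp only [mem_filter] at hU
    exact sdiff_union_of_subset (hPsub hU.2.1 hU.2.2)
  · intro W hW'
    simp only [mem_shellIn] at hW'
    obtain ⟨_, _, hdisj⟩ := hW hW'.1
    show (W ∪ {v, π v}) \ {v, π v} = W
    rw [union_sdiff_right, sdiff_eq_self_of_disjoint hdisj]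
  · intro U hU
    simp only [mem_filter] at hU
    show g U = g (U \ {v, π v} ∪ {v, π v})
    rw [sdiff_union_of_subset (hPsub hU.2.1 hU.2.2)]

/-- **Pinning two full edges is deleting them** (sum form): for `b, a ∈ S` on different edges,
`Σ_{U ∈ Shell_S(t+4,c), e_b ∪ e_a ⊆ U} g(U) = Σ_{W ∈ Shell_{S∖e_b∖e_a}(t,c)} g(W ∪ e_a ∪ e_b)`.
[cite: Rothvoss2017, §2 (PDF p. 6)] -/
theorem sum_shellIn_full_full_eq {S : Finset (Fin n)} (hS : ∀ v ∈ S, π v ∈ S) {b a : Fin n}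
    (hb : b ∈ S) (ha : a ∈ S) (hab : a ≠ b) (haπ : a ≠ π b) (t c : ℕ) (g : Finset (Fin n) → ℝ) :
    ∑ U ∈ (shellIn π S (t + 4) c).filter
        (fun U => (b ∈ U ∧ π b ∈ U) ∧ (a ∈ U ∧ π a ∈ U)), g U =
      ∑ W ∈ shellIn π (del2 π S b a) t c, g (W ∪ {a, π a} ∪ {b, π b}) := by
  have ha' : a ∈ S \ {b, π b} := by
    rw [mem_sdiff, mem_insert, mem_singleton, not_or]; exact ⟨ha, hab, haπ⟩
  have hπa' : π a ∉ ({b, π b} : Finset (Fin n)) := by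
    rw [mem_insert, mem_singleton, not_or]
    exact ⟨fun e => haπ ((π_eq_iff hπ).1 e), fun e => hab (π_injective hπ e)⟩
  rw [← filter_filter, sum_filter, sum_shellIn_full_eq hπ hπ' hS hb (t + 2) c]
  have hcond : ∀ W' : Finset (Fin n),
      (a ∈ W' ∪ {b, π b} ∧ π a ∈ W' ∪ {b, π b}) ↔ (a ∈ W' ∧ π a ∈ W') := by
    intro W'
    rw [mem_union, mem_union, or_iff_left (mem_sdiff.1 ha').2, or_iff_left hπa']
  rw [sum_congr rfl fun W' _ => if_congr (hcond W') rfl rfl, ← sum_filter,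
    sum_shellIn_full_eq hπ hπ' (sdiff_pair_stable hπ hS b) ha' t c, ← del2_eq_sdiff_sdiff]

omit hπ hπ' in
/-- A filtered count as a sum of an indicator (cast to `ℝ`). [folklore] -/
private theorem card_filter_cast_eq_sum (s : Finset (Finset (Fin n))) (p : Finset (Fin n) → Prop)
    [DecidablePred p] :
    (((s.filter p).card : ℕ) : ℝ) = ∑ U ∈ s, if p U then (1 : ℝ) else 0 := by
  rw [card_filter]; push_cast; rfl

/-- **Pinning one full edge** (block-statistic count):
`#{U ∈ Shell_S(t+2,c) : v,πv ∈ U, |U ∩ H| = x} = Sh_{S∖e_v}(t,c; x − |e_v ∩ H|)`.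
[cite: Rothvoss2017, §2 (PDF p. 6)] -/
theorem card_shellIn_full_inter_eq {S : Finset (Fin n)} (hS : ∀ v ∈ S, π v ∈ S)
    (H : Finset (Fin n)) {v : Fin n} (hv : v ∈ S) (t c : ℕ) (x : ℤ) :
    ((((shellIn π S (t + 2) c).filter fun U =>
        (v ∈ U ∧ π v ∈ U) ∧ ((U ∩ H).card : ℤ) = x).card : ℕ) : ℝ) =
      shellCount π (S \ {v, π v}) H t c (x - (({v, π v} ∩ H).card : ℤ)) := by
  rw [shellCount, ← filter_filter, card_filter_cast_eq_sum, card_filter_cast_eq_sum,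
    sum_shellIn_full_eq hπ hπ' hS hv]
  refine sum_congr rfl fun W hW => ?_
  rw [mem_shellIn] at hW
  have hvW : v ∉ W := fun h => by have := mem_sdiff.1 (hW.1 h); simp at this
  have hπvW : π v ∉ W := fun h => by have := mem_sdiff.1 (hW.1 h); simp at this
  rw [card_inter_union_pair hvW hπvW H]
  exact if_congr eq_sub_iff_add_eq.symm rfl rfl

/-- **Pinning two full edges** (block-statistic count): for `b, a ∈ S` on different edges,
`#{U ∈ Shell_S(t+4,c) : e_b ∪ e_a ⊆ U, |U ∩ H| = x} = Sh_{S∖e_b∖e_a}(t,c; x − |e_b ∩ H| − |e_a ∩ H|)`.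
(The same statement, proved independently the same hour via the predicate-threaded one-edge pin, is
`ShellStep.card_pin_two_eq_shellCount` in `ShellLawPinning.lean`, prover g21 p639846; cite either.)
[cite: Rothvoss2017, §2 (PDF p. 6)] -/
theorem card_shellIn_full_full_inter_eq {S : Finset (Fin n)} (hS : ∀ v ∈ S, π v ∈ S)
    (H : Finset (Fin n)) {b a : Fin n} (hb : b ∈ S) (ha : a ∈ S) (hab : a ≠ b) (haπ : a ≠ π b)
    (t c : ℕ) (x : ℤ) :
    ((((shellIn π S (t + 4) c).filter fun U =>
        ((b ∈ U ∧ π b ∈ U) ∧ (a ∈ U ∧ π a ∈ U)) ∧ ((U ∩ H).card : ℤ) = x).card : ℕ) : ℝ) =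
      shellCount π (del2 π S b a) H t c
        (x - (({b, π b} ∩ H).card : ℤ) - (({a, π a} ∩ H).card : ℤ)) := by
  rw [shellCount, ← filter_filter, card_filter_cast_eq_sum, card_filter_cast_eq_sum,
    sum_shellIn_full_full_eq hπ hπ' hS hb ha hab haπ]
  refine sum_congr rfl fun W hW => ?_
  rw [mem_shellIn] at hW
  have hmem : ∀ {u : Fin n}, u ∈ W → u ∈ del2 π S b a := fun hu => hW.1 hu
  have haW : a ∉ W := fun h => by have := mem_del2.1 (hmem h); exact this.2.2.2.1 rfl
  have hπaW : π a ∉ W := fun h => by have := mem_del2.1 (hmem h); exact this.2.2.2.2 rfl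
  have hbW : b ∉ W ∪ {a, π a} := fun h => by
    rcases mem_union.1 h with h | h
    · exact (mem_del2.1 (hmem h)).2.1 rfl
    · rw [mem_insert, mem_singleton] at h
      rcases h with h | h
      · exact hab h.symm
      · exact haπ ((π_eq_iff hπ).1 h.symm)
  have hπbW : π b ∉ W ∪ {a, π a} := fun h => by
    rcases mem_union.1 h with h | h
    · exact (mem_del2.1 (hmem h)).2.2.1 rfl
    · rw [mem_insert, mem_singleton] at h
      rcases h with h | h
      · exact haπ h.symm
      · exact hab (π_injective hπ h).symm
  rw [card_inter_union_pair hbW hπbW H, card_inter_union_pair haW hπaW H]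
  refine if_congr ?_ rfl rfl
  constructor
  · intro h; rw [← h]; ring
  · intro h; rw [h]; ring

omit hπ hπ' in
/-- On the shell `Shell_S(t+2,c)` every cut has `t + 2 − c` fully matched vertices (as a real number).
[cite: Rothvoss2017, §2 (PDF p. 6)] -/
theorem card_full_cast_of_mem_shellIn {S : Finset (Fin n)} {t c : ℕ} {U : Finset (Fin n)}
    (hU : U ∈ shellIn π S (t + 2) c) : ((full π U).card : ℝ) = (t : ℝ) + 2 - c := by
  rw [card_full_of_mem_shellIn hU]
  have := le_of_mem_shellIn hU
  push_cast [Nat.cast_sub this]; ring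

/-- **The pinned fraction, one edge**: `|S| · |Shell_{S∖e_v}(t,c)| = (t+2−c) · |Shell_S(t+2,c)|`
(double count of (cut, full vertex) + the pin bijection + size invariance of `|Shell|`); i.e. the edge
`e_v` is full in a fraction `s/N` of the shell, `2s = t+2−c`, `2N = |S|`.
(Twin: `ShellStep.card_shellIn_sdiff_pair_ratio` in `ShellLawPinning.lean`, prover g21 p639846 — same
statement, independent proof; referee NIT-g70-g.) [cite: Rothvoss2017, §2 (PDF p. 6)] -/
theorem card_mul_card_shellIn_sdiff_pair {S : Finset (Fin n)} (hS : ∀ v ∈ S, π v ∈ S) {v : Fin n}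
    (hv : v ∈ S) (t c : ℕ) :
    (S.card : ℝ) * (shellIn π (S \ {v, π v}) t c).card =
      ((t : ℝ) + 2 - c) * (shellIn π S (t + 2) c).card := by
  -- double count the pairs `(w, U)`, `w ∈ S`, `U ∈ Shell_S(t+2,c)`, `w, πw ∈ U`
  have key : ∑ w ∈ S, ((((shellIn π S (t + 2) c).filter fun U => w ∈ U ∧ π w ∈ U).card : ℕ) : ℝ) =
      ∑ U ∈ shellIn π S (t + 2) c, ((full π U).card : ℝ) := by
    simp_rw [card_filter_cast_eq_sum]
    rw [sum_comm]
    refine sum_congr rfl fun U hU => ?_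
    rw [← sum_filter]
    have hUS : U ⊆ S := (mem_shellIn.1 hU).1
    have e : S.filter (fun w => w ∈ U ∧ π w ∈ U) = full π U := by
      ext w
      rw [mem_filter, mem_full]
      exact ⟨fun h => h.2, fun h => ⟨hUS h.1, h⟩⟩
    rw [e, sum_const, nsmul_eq_mul, mul_one]
  have lhs : ∀ w ∈ S, ((((shellIn π S (t + 2) c).filter fun U => w ∈ U ∧ π w ∈ U).card : ℕ) : ℝ) =
      ((shellIn π (S \ {v, π v}) t c).card : ℝ) := by
    intro w hw
    rw [card_shellIn_full hπ hπ' hS hw]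
    have h1 := card_sdiff_pair hπ' hS hw
    have h2 := card_sdiff_pair hπ' hS hv
    exact_mod_cast card_shellIn_eq_of_card_eq hπ hπ' _ rfl (by omega) (sdiff_pair_stable hπ hS w)
      (sdiff_pair_stable hπ hS v) t c
  have rhs : ∑ U ∈ shellIn π S (t + 2) c, ((full π U).card : ℝ) =
      ((t : ℝ) + 2 - c) * (shellIn π S (t + 2) c).card := by
    rw [sum_congr rfl fun U hU => card_full_cast_of_mem_shellIn hU, sum_const, nsmul_eq_mul, mul_comm]
  rw [sum_congr rfl lhs, sum_const, nsmul_eq_mul] at key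
  rw [key, rhs]

/-- **The pinned fraction, two edges**: `|S|(|S|−2) · |Shell_{S∖e_b∖e_a}(t,c)| = (t+4−c)(t+2−c) · |Shell_S(t+4,c)|`,
i.e. two given edges are both full in a fraction `s(s−1)/(N(N−1))` of the shell, `2s = t+4−c`, `2N = |S|`.
(Twin: `ShellStep.card_shellIn_del2_full_ratio` in `ShellLawPinning.lean`, prover g21 p639846; the
shell-average form of the two-edge pin is `ShellStep.shellAvg_pin_two_eq` there.)
[cite: Rothvoss2017, §2 (PDF p. 6)] -/
theorem card_mul_card_shellIn_del2_full {S : Finset (Fin n)} (hS : ∀ v ∈ S, π v ∈ S) {b a : Fin n}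
    (hb : b ∈ S) (ha : a ∈ S) (hab : a ≠ b) (haπ : a ≠ π b) (t c : ℕ) :
    (S.card : ℝ) * ((S.card : ℝ) - 2) * (shellIn π (del2 π S b a) t c).card =
      ((t : ℝ) + 4 - c) * ((t : ℝ) + 2 - c) * (shellIn π S (t + 4) c).card := by
  have ha' : a ∈ S \ {b, π b} := by
    rw [mem_sdiff, mem_insert, mem_singleton, not_or]; exact ⟨ha, hab, haπ⟩
  have h1 := card_mul_card_shellIn_sdiff_pair hπ hπ' hS hb (t + 2) c
  have h2 := card_mul_card_shellIn_sdiff_pair hπ hπ' (sdiff_pair_stable hπ hS b) ha' t c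
  rw [← del2_eq_sdiff_sdiff] at h2
  have hcard : ((S \ {b, π b}).card : ℝ) = (S.card : ℝ) - 2 := by
    have := card_sdiff_pair hπ' hS hb
    rw [← this]; push_cast; ring
  rw [hcard] at h2
  have e : ((t + 2 : ℕ) : ℝ) + 2 - c = (t : ℝ) + 4 - c := by push_cast; ring
  rw [e] at h1
  calc (S.card : ℝ) * ((S.card : ℝ) - 2) * (shellIn π (del2 π S b a) t c).card
      = (S.card : ℝ) * (((S.card : ℝ) - 2) * (shellIn π (del2 π S b a) t c).card) := by ring
    _ = (S.card : ℝ) * (((t : ℝ) + 2 - c) * (shellIn π (S \ {b, π b}) (t + 2) c).card) := by rw [h2]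
    _ = ((t : ℝ) + 2 - c) * ((S.card : ℝ) * (shellIn π (S \ {b, π b}) (t + 2) c).card) := by ring
    _ = ((t : ℝ) + 4 - c) * ((t : ℝ) + 2 - c) * (shellIn π S (t + 4) c).card := by rw [h1]; ring

/-- **The tilted law, one edge**: the law of `|U ∩ H|` on `Shell_S(t+2,c)` jointly with the event
`e_v ⊆ U` is `((t+2−c)/|S|) · law_{S∖e_v}(t,c; x − |e_v ∩ H|)` — a polynomial of degree `1` in the
level times a deleted, shifted shell law. [cite: Rothvoss2017, §2 (PDF p. 6)] -/
theorem pinnedLaw_one_eq {S : Finset (Fin n)} (hS : ∀ v ∈ S, π v ∈ S) (H : Finset (Fin n))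
    {v : Fin n} (hv : v ∈ S) (t c : ℕ) (x : ℤ) :
    ((((shellIn π S (t + 2) c).filter fun U =>
        (v ∈ U ∧ π v ∈ U) ∧ ((U ∩ H).card : ℤ) = x).card : ℕ) : ℝ) / (shellIn π S (t + 2) c).card =
      ((t : ℝ) + 2 - c) / S.card * shellLaw π (S \ {v, π v}) H t c (x - (({v, π v} ∩ H).card : ℤ)) := by
  rw [card_shellIn_full_inter_eq hπ hπ' hS H hv, shellLaw]
  have hratio := card_mul_card_shellIn_sdiff_pair hπ hπ' hS hv t c
  have hSpos : (0 : ℝ) < S.card := by exact_mod_cast card_pos.2 ⟨v, hv⟩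
  rcases (shellIn π (S \ {v, π v}) t c).eq_empty_or_nonempty with h0 | ⟨W, hW⟩
  · -- empty deleted shell: both sides vanish
    have hc0 : shellCount π (S \ {v, π v}) H t c (x - (({v, π v} ∩ H).card : ℤ)) = 0 := by
      rw [shellCount, h0, filter_empty, card_empty, Nat.cast_zero]
    rw [hc0, zero_div, zero_div, mul_zero]
  · have hFpos : (0 : ℝ) < (shellIn π (S \ {v, π v}) t c).card := by
      exact_mod_cast card_pos.2 ⟨W, hW⟩
    have hTne : ((shellIn π S (t + 2) c).card : ℝ) ≠ 0 := by
      intro h0; rw [h0, mul_zero] at hratio; exact (mul_pos hSpos hFpos).ne' hratio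
    rw [div_mul_div_comm, div_eq_div_iff hTne (mul_pos hSpos hFpos).ne', hratio]
    ring

/-- **The tilted law, two edges**: the law of `|U ∩ H|` on `Shell_S(t+4,c)` jointly with the event
`e_b ∪ e_a ⊆ U` (different edges) is `((t+4−c)(t+2−c)/(|S|(|S|−2))) · law_{S∖e_b∖e_a}(t,c; x − |e_b ∩ H| − |e_a ∩ H|)`
— a polynomial of degree `2` in the level times a deleted, shifted shell law (LIT-44 §7: by the Leibniz
rule the `m`-th level difference of a tilted block statistic needs the level differences of orders
`m−2, m−1, m` of deleted shell laws only). [cite: Rothvoss2017, §2 (PDF p. 6)] -/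
theorem pinnedLaw_two_eq {S : Finset (Fin n)} (hS : ∀ v ∈ S, π v ∈ S) (H : Finset (Fin n))
    {b a : Fin n} (hb : b ∈ S) (ha : a ∈ S) (hab : a ≠ b) (haπ : a ≠ π b) (t c : ℕ) (x : ℤ) :
    ((((shellIn π S (t + 4) c).filter fun U =>
        ((b ∈ U ∧ π b ∈ U) ∧ (a ∈ U ∧ π a ∈ U)) ∧ ((U ∩ H).card : ℤ) = x).card : ℕ) : ℝ) /
        (shellIn π S (t + 4) c).card =
      ((t : ℝ) + 4 - c) * ((t : ℝ) + 2 - c) / (S.card * ((S.card : ℝ) - 2)) *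
        shellLaw π (del2 π S b a) H t c
          (x - (({b, π b} ∩ H).card : ℤ) - (({a, π a} ∩ H).card : ℤ)) := by
  rw [card_shellIn_full_full_inter_eq hπ hπ' hS H hb ha hab haπ, shellLaw]
  have hratio := card_mul_card_shellIn_del2_full hπ hπ' hS hb ha hab haπ t c
  have hS4 : (4 : ℝ) ≤ S.card := by
    have := card_del2_add_four hπ hπ' hS hb ha hab haπ
    exact_mod_cast (show 4 ≤ S.card by omega)
  rcases (shellIn π (del2 π S b a) t c).eq_empty_or_nonempty with h0 | ⟨W, hW⟩
  · have hc0 : shellCount π (del2 π S b a) H t c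
        (x - (({b, π b} ∩ H).card : ℤ) - (({a, π a} ∩ H).card : ℤ)) = 0 := by
      rw [shellCount, h0, filter_empty, card_empty, Nat.cast_zero]
    rw [hc0, zero_div, zero_div, mul_zero]
  · have hFpos : (0 : ℝ) < (shellIn π (del2 π S b a) t c).card := by
      exact_mod_cast card_pos.2 ⟨W, hW⟩
    have hSS : (0 : ℝ) < S.card * ((S.card : ℝ) - 2) := mul_pos (by linarith) (by linarith)
    have hTne : ((shellIn π S (t + 4) c).card : ℝ) ≠ 0 := by
      intro h0; rw [h0, mul_zero] at hratio; exact (mul_pos hSS hFpos).ne' hratio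
    rw [div_mul_div_comm, div_eq_div_iff hTne (mul_pos hSS hFpos).ne', hratio]
    ring

/-- **Profile form** (for the level-difference calculus of `ShellLawLevelStep` §6 /
`ShellLawSmoothing`): at fixed cut size `t + 4`, as a function of the level `c` and the value `x`, the
two-edge tilted law is the product of the scalar level profile `c ↦ (t+4−c)(t+2−c)/(|S|(|S|−2))` and the
shifted shell-law profile of `S ∖ e_b ∖ e_a` at cut size `t`. [cite: Rothvoss2017, §2 (PDF p. 6)] -/
theorem pinnedLaw_two_profile {S : Finset (Fin n)} (hS : ∀ v ∈ S, π v ∈ S) (H : Finset (Fin n))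
    {b a : Fin n} (hb : b ∈ S) (ha : a ∈ S) (hab : a ≠ b) (haπ : a ≠ π b) (t : ℕ) :
    (fun (c : ℕ) (x : ℤ) =>
        ((((shellIn π S (t + 4) c).filter fun U =>
          ((b ∈ U ∧ π b ∈ U) ∧ (a ∈ U ∧ π a ∈ U)) ∧ ((U ∩ H).card : ℤ) = x).card : ℕ) : ℝ) /
          (shellIn π S (t + 4) c).card) =
      fun (c : ℕ) (x : ℤ) =>
        ((t : ℝ) + 4 - c) * ((t : ℝ) + 2 - c) / (S.card * ((S.card : ℝ) - 2)) *
          shellLaw π (del2 π S b a) H t c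
            (x - (({b, π b} ∩ H).card : ℤ) - (({a, π a} ∩ H).card : ℤ)) := by
  funext c x
  exact pinnedLaw_two_eq hπ hπ' hS H hb ha hab haπ t c x


end EdgeProduct

end ShellStep

end Literature.Combinatorics.Optimization

end
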